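import Summits.CriticalPhenomena.SAWScalingLimit.Theorems.CriticalBubbleBound.Negative.CriticalBubbleBoundSubcritical

/-!
# Negative-side results for the crux `SAWTotalPositivity.CriticalBubbleBound` (stmt-CriticalPhenomena-7117):
prover-facing sufficient conditions (counting series, closing bound `c_n(e)x_c^n ≤ K(n+1)^{-1-ε}`), planner notes on the HalfPlaneBubble split, TP₂, other dimensions; typed `halfPlaneBubble ≤ bubble`, target shape `ClosingBound ε` (work-file §7, §9).

Refuter `cdisprove` (standing adversary); the full indexed work file is
`Summits/CriticalPhenomena/SAWScalingLimit/Cruxes/CriticalBubbleBound/Disproof.lean`.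
-/

noncomputable section

open MeasureTheory Filter Topology Set Function
open Literature.Probability.LatticeModels Literature.Probability.Percolation
open Literature.Probability.RandomPlanarGeometry Literature.Probability.RandomPlanarGeometry.SAW
open Literature.Barriers.CriticalPhenomena.SupercriticalSAW
open scoped ENNReal NNReal BigOperators

namespace Summit.CriticalPhenomena.SAWScalingLimit.Theorems.CriticalBubbleBound.Negative

open Summit.CriticalPhenomena.SAWScalingLimit.Theses.SAWTotalPositivity (CriticalBubbleBound)

/-! ## §7 Prover-facing SUFFICIENT conditions (what a proof has to deliver) -/

/-- Reduction to counting: the crux follows from the finiteness of the four series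
`Σ_n c_n(e) x_c^n`, `e` a unit vector. (Also necessary, by §1 + §5.) [cite: MadrasSlade1993, §1.4] -/
theorem criticalBubbleBound_of_tsum_countAt_ne_top
    (h : ∀ e : Site 2, (zdGraph 2).Adj 0 e →
      ∑' n : ℕ, (Zd.countAt 2 n e : ℝ≥0∞) * ENNReal.ofReal (criticalFugacity ^ n) ≠ ⊤) :
    CriticalBubbleBound := by
  rw [criticalBubbleBound_iff_bubble_ne_top]
  intro e he
  rw [bubble, latticeKernel_zero_eq_tsum_countAt]
  exact h e he

/-- The crux IS the finiteness of the four counting series (necessary and sufficient). [cite: MadrasSlade1993, §1.4] -/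
theorem criticalBubbleBound_iff_tsum_countAt_ne_top :
    CriticalBubbleBound ↔ ∀ e : Site 2, (zdGraph 2).Adj 0 e →
      ∑' n : ℕ, (Zd.countAt 2 n e : ℝ≥0∞) * ENNReal.ofReal (criticalFugacity ^ n) ≠ ⊤ := by
  refine ⟨fun h e he => ?_, criticalBubbleBound_of_tsum_countAt_ne_top⟩
  rw [← latticeKernel_zero_eq_tsum_countAt]
  exact (criticalBubbleBound_iff_bubble_ne_top.1 h) e he

/-- **Closing-probability form** (the realistic target): a polynomial gain `c_n(e) x_c^n ≤
K (n+1)^{-(1+ε)}` for the unit vectors `e` — i.e. `c_n(0,e) ≤ K n^{-1-ε} μ^n`, equivalently a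
polygon bound `p_m ≤ K' m^{-2-ε} μ^m` — implies the crux (`p`-series). The conjectured truth is
`ε = 1/2` (`p_m ~ B μ^m m^{-5/2}`); in print: Madras 1995 gives only `m^{-1/2}`, Hammond 2018
`m^{-3/2+o(1)}` on a density-one set — both insufficient. [cite: MadrasSlade1993, §1.4] -/
theorem criticalBubbleBound_of_closing_bound {K ε : ℝ} (hε : 0 < ε)
    (h : ∀ e : Site 2, (zdGraph 2).Adj 0 e → ∀ n : ℕ,
      (Zd.countAt 2 n e : ℝ) * criticalFugacity ^ n ≤ K * ((n : ℝ) + 1) ^ (-(1 + ε))) :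
    CriticalBubbleBound := by
  apply criticalBubbleBound_of_tsum_countAt_ne_top
  intro e he
  have hK : ∀ n : ℕ, (Zd.countAt 2 n e : ℝ≥0∞) * ENNReal.ofReal (criticalFugacity ^ n) ≤
      ENNReal.ofReal (K * ((n : ℝ) + 1) ^ (-(1 + ε))) := fun n => by
    rw [← ENNReal.ofReal_natCast, ← ENNReal.ofReal_mul (Nat.cast_nonneg _)]
    exact ENNReal.ofReal_le_ofReal (h e he n)
  refine ne_top_of_le_ne_top ?_ (ENNReal.tsum_le_tsum hK)
  have hs : Summable fun n : ℕ => K * ((n : ℝ) + 1) ^ (-(1 + ε)) := by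
    refine Summable.mul_left K ?_
    have h1 : Summable fun n : ℕ => ((n : ℝ)) ^ (-(1 + ε)) :=
      Real.summable_nat_rpow.2 (by linarith)
    simpa using (summable_nat_add_iff 1).2 h1
  rw [← ENNReal.ofReal_tsum_of_nonneg (fun n => ?_) hs]
  · exact ENNReal.ofReal_ne_top
  · exact le_trans (mul_nonneg (Nat.cast_nonneg _) (pow_nonneg criticalFugacity_pos_lt_one'.1.le n))
      (h e he n)

/-! ## §9 Notes for planners and provers (typed where cheap)

### 9a. The foreseen split `CriticalBubbleBound ⇐ HalfPlaneBubble → BulkFromBoundary`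

The route text foresees `HalfPlaneBubble` (arch generating function between adjacent boundary
points of a half-plane finite) `→ BulkFromBoundary → CriticalBubbleBound`. Two warnings.

(1) `BulkFromBoundary` is NOT glue. With `q_m := c_{m-1}(0,e)` = number of `m`-gons (edge sets)
through a fixed edge, `q_m = (m/2) p_m` (each of the `p_m` polygon classes has `m` edges, half of
them parallel to `e` on average by the quarter-turn symmetry of the COUNT), so
`G_{x_c}(0,e) = x_c + Σ_{m ≥ 4} (m/2) p_m x_c^{m-1}`, whereas the half-plane arch function between
the two adjacent boundary sites only sees the polygons rooted at an edge of their LOWEST row: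
`A(x_c) = Σ_m r_m x_c^{m-1}` with `p_m ≤ r_m ≤ (m/2) p_m` (`r_m` = Σ over classes of the number of
bottom-row edges). Finiteness of `A` gives `Σ p_m x_c^m < ∞` at best, which does NOT give
`Σ m p_m x_c^m < ∞`: the multiplicity factor `m` (where along the polygon the root edge sits) is
exactly the difference between boundary and bulk rooting. Any `BulkFromBoundary` needs an extra
mechanism controlling the height of the root edge above the lowest row (a renewal / "unfolding
with polynomial loss" statement), i.e. it is a crux of the same depth as the bubble itself.

(2) What the route CONSUMES is not the half-plane quantity anyway. `TPToHarnack`/`BoundaryHarnack`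
need `Z_Ω(b,c) ≤ C` for DOMAIN-adjacent consecutive boundary sites over ALL bounded simply
connected `Ω` — including the two sides `b, c` of the tip of a deep thin cut, whose SAWs `b → c`
exhaust, as the domain grows, all SAWs of `ℤ²` from `b` to `c` avoiding a half-line issuing from
the edge `bc`: the SLIT-PLANE bubble `S`, with `A ≤ S ≤ G`. So even a proof of `HalfPlaneBubble`
plus TP₂ leaves the route's Harnack constant uncontrolled at slit tips; the honest intermediate
target is `S < ∞` (or the full `G < ∞`, the crux), not `A < ∞`.

(3) Lattice remark: on the HEXAGONAL lattice the half-plane arch function IS bounded at `x_c`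
(Duminil-Copin–Smirnov 2012, strip identity `1 = c_α A_T + B_T + c_ε E_T`, so `A_T ≤ 1/cos(3π/8)`
uniformly in the strip width) — the parafermionic observable delivers exactly the boundary
quantity `A`, and still not the bulk/slit quantities `G`, `S`. On `ℤ²` even `A < ∞` is open.

### 9b. Why TP₂ cannot supply the constant
`BoundaryTP2` is homogeneous of degree zero under rescaling all partition functions: every
instance `Z(p₁,p₃)Z(p₂,p₄) ≤ Z(p₁,p₂)Z(p₃,p₄)` bounds a product by a product. An ADJACENT pair
`u ∼ v` can sit on the small side only as `(p₁,p₃) = (u,v)` with a boundary point `p₂` between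
them in the cyclic order, i.e. only across the mouth of a cut separating `u` from `v` along the
boundary; the resulting bound `Z(u,v) ≤ Z(u,p₂)Z(v,p₄)/Z(p₂,p₄)` has another adjacent-type or
long-range factor on the right and a long-range factor in the denominator — no absolute constant
ever appears. Consistent with the planner's "(the one absolute constant TP cannot supply)".

### 9c. Other dimensions / models (scope of the difficulty)
The same typed statement over `zdGraph d`, `d ≥ 5`, is a THEOREM (Hara–Slade: the bubble diagram
`B(z_c) = Σ_x G_{z_c}(0,x)² < ∞`, hence `G_{z_c}(0,e)² ≤ B(z_c) < ∞`; cf. the tree's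
`Literature/Barriers/CriticalPhenomena/LaceExpansionBubbleFiveDim*.lean`). For simple random walk
the analogue is FALSE in `d = 2` (recurrence: the critical Green function is infinite) — Madras–Slade
p. 37 stress this contrast; finiteness for SAW in `d = 2` rests on `α_sing < 1`, for which no soft
argument is known. Nothing in the typed crux lets a prover import the `d ≥ 5` or the Gaussian case.
-/

/-- SAWs of `ℤ²` from `0` to `e₀` staying in the closed upper half-plane `{y ≥ 0}` ("arches"
between two adjacent boundary sites of the half-plane). [cite: MadrasSlade1993, §1.2 (half-space walks)] -/
def HalfPlaneSAW : Type := {p : LatticeSAW 0 e₀ // ∀ w ∈ p.1.support, 0 ≤ w 1}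

/-- The critical HALF-PLANE bubble `A = Σ_{arches 0 → e₀} x_c^{|γ|} ∈ [0,∞]`. -/
def halfPlaneBubble : ℝ≥0∞ :=
  ∑' p : HalfPlaneSAW, ENNReal.ofReal (criticalFugacity ^ p.1.1.length)

/-- The planner's foreseen layer-2 crux `HalfPlaneBubble`, typed intrinsically on `ℤ²`. -/
def HalfPlaneBubbleFinite : Prop := halfPlaneBubble ≠ ⊤

/-- `A ≤ G`: the half-plane bubble is dominated by the bulk bubble. [folklore] -/
theorem halfPlaneBubble_le_bubble : halfPlaneBubble ≤ bubble e₀ := by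
  rw [halfPlaneBubble, bubble, latticeKernel]
  exact ENNReal.tsum_comp_le_tsum_of_injective Subtype.val_injective
    (fun p : LatticeSAW 0 e₀ => ENNReal.ofReal (criticalFugacity ^ p.1.length))

/-- The crux implies the planner's `HalfPlaneBubble` (trivially); the CONVERSE ("BulkFromBoundary")
is where the multiplicity factor `m` lives (§9a) and is not glue. [folklore] -/
theorem halfPlaneBubbleFinite_of_criticalBubbleBound (h : CriticalBubbleBound) : HalfPlaneBubbleFinite :=
  ne_top_of_le_ne_top ((criticalBubbleBound_iff_bubble_ne_top.1 h) e₀ adj_zero_e₀) halfPlaneBubble_le_bubble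

/-- A lattice SAW `0 → e₀` AVOIDS THE CUT below the edge `{0, e₀}` if it never steps between the
sites `(0, y)` and `(1, y)` for any `y ≤ -1` (the cut `{1/2} × (-∞, -1/2]`, whose end is the
midpoint region just below the root edge; the root edge itself is not cut). These are the SAWs
seen, in the limit of large domains, between the two boundary sites at the TIP of a deep thin cut
— the configuration in which the route's `BoundaryHarnack`/`TPToHarnack` consume the constant. -/
def AvoidsCut (p : LatticeSAW 0 e₀) : Prop :=
  ∀ y : ℤ, y ≤ -1 → s((![0, y] : Site 2), ![1, y]) ∉ p.1.edges

/-- The critical SLIT-PLANE bubble `S = Σ_{γ : 0 → e₀ avoiding the cut} x_c^{|γ|}`. -/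
def slitPlaneBubble : ℝ≥0∞ :=
  ∑' p : {p : LatticeSAW 0 e₀ // AvoidsCut p}, ENNReal.ofReal (criticalFugacity ^ p.1.1.length)

/-- Half-plane arches avoid the cut (they never visit a site with negative ordinate). [folklore] -/
theorem avoidsCut_of_halfPlane (p : HalfPlaneSAW) : AvoidsCut p.1 := by
  intro y hy hmem
  have h0 : (![0, y] : Site 2) ∈ p.1.1.support := p.1.1.fst_mem_support_of_mem_edges hmem
  have := p.2 _ h0
  simp at this
  omega

/-- `A ≤ S`: the half-plane bubble is dominated by the slit-plane bubble. [folklore] -/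
theorem halfPlaneBubble_le_slitPlaneBubble : halfPlaneBubble ≤ slitPlaneBubble := by
  rw [halfPlaneBubble, slitPlaneBubble]
  let F : HalfPlaneSAW → {p : LatticeSAW 0 e₀ // AvoidsCut p} := fun p => ⟨p.1, avoidsCut_of_halfPlane p⟩
  have hF : Injective F := fun p q h => Subtype.ext (congrArg (fun r : {p : LatticeSAW 0 e₀ // AvoidsCut p} => r.1) h)
  exact ENNReal.tsum_comp_le_tsum_of_injective hF
    (fun q : {p : LatticeSAW 0 e₀ // AvoidsCut p} => ENNReal.ofReal (criticalFugacity ^ q.1.1.length))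

/-- `S ≤ G`: the slit-plane bubble is dominated by the bulk bubble. [folklore] -/
theorem slitPlaneBubble_le_bubble : slitPlaneBubble ≤ bubble e₀ := by
  rw [slitPlaneBubble, bubble, latticeKernel]
  exact ENNReal.tsum_comp_le_tsum_of_injective Subtype.val_injective
    (fun p : LatticeSAW 0 e₀ => ENNReal.ofReal (criticalFugacity ^ p.1.length))

/-- The three-level chain `A ≤ S ≤ G` (half-plane ≤ slit-plane ≤ bulk). What the route needs at
slit tips is `S < ∞`; what the foreseen layer-2 crux offers is `A < ∞`; what the crux states is
`G < ∞`. Only `G < ∞ ⇒ S < ∞ ⇒ A < ∞` are free.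

EXPONENT LEDGER (heuristic, `p_m = m^{-θ} μ^m`, `ν = 3/4`; exact combinatorics, conjectural
exponents): in polygon language the three series count the `m`-gons with a multiplicity —
`G`: `(m/2) p_m` (root edge anywhere: finite iff `θ > 2`); `S`: `Σ_P width(P) ≍ m^ν p_m` (the root
edge must be the LOWEST edge of the polygon in its column strip — one per occupied strip — since
the cut below the root must stay in the exterior: finite iff `θ > 1 + ν = 7/4`); `A`:
`Σ_P #{edges of P on its lowest row} ≍ p_m` up to `m^{o(1)}` (finite iff `θ > 1`, morally). With the
predicted `θ = 5/2` all three converge; with the best proved `θ_n ≥ 3/2 - δ` (density one, Hammond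
2018) none is settled. So restating the crux "for boundary pairs only" does NOT buy the half-plane
threshold: slit tips keep it at `7/4`, interior pairs at `2`. [folklore] -/
theorem bubble_chain : halfPlaneBubble ≤ slitPlaneBubble ∧ slitPlaneBubble ≤ bubble e₀ :=
  ⟨halfPlaneBubble_le_slitPlaneBubble, slitPlaneBubble_le_bubble⟩

/-! ### 9d. Realistic intermediate TARGETS (near-misses we cannot close; no `sorry` kept)

* `ClosingBound ε` below with ANY `ε > 0` closes the crux (`criticalBubbleBound_of_closing_bound`);
  in print `ε` would have to beat Hammond's density-one `n^{-3/2+o(1)}` polygon bound by making it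
  hold for ALL `n` with an extra factor `n^{-1/2-ε}` — open.
* Equivalently a polygon bound `p_m ≤ K m^{-2-ε} μ^m` for all even `m`.
* NOT sufficient (do not file): `p_m ≤ μ^m` (Kesten/Hammersley, gives `Σ m · 1`), Madras's
  `p_m ≤ C m^{-1/2} μ^m`, any bound on `c_n` alone, any susceptibility / `ℓ¹` bound (§6), any
  statement open in the fugacity (§4), TP₂ alone (§9b). -/

/-- TARGET SHAPE for provers: a polynomial closing bound with exponent `1 + ε`. At `ε = 1/2` this
is the conjectured truth `c_n(0,e) ≍ n^{-3/2} μ^n`. [cite: MadrasSlade1993, §1.4] -/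
def ClosingBound (ε : ℝ) : Prop :=
  ∃ K : ℝ, ∀ e : Site 2, (zdGraph 2).Adj 0 e → ∀ n : ℕ,
    (Zd.countAt 2 n e : ℝ) * criticalFugacity ^ n ≤ K * ((n : ℝ) + 1) ^ (-(1 + ε))

/-- Any positive `ε` in `ClosingBound ε` proves the crux. [cite: MadrasSlade1993, §1.4] -/
theorem criticalBubbleBound_of_closingBound {ε : ℝ} (hε : 0 < ε) (h : ClosingBound ε) :
    CriticalBubbleBound := by
  obtain ⟨K, hK⟩ := h
  exact criticalBubbleBound_of_closing_bound hε hK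

end Summit.CriticalPhenomena.SAWScalingLimit.Theorems.CriticalBubbleBound.Negative
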